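/-
Copyright (c) 2026 the pub-hodgecm-mathlib formalisation cell (harness21).  Prover seat hodgecm-mathlib-K2Liu-p14 (g5) (cross-line VALVE 16 (n) hand at section S6,
dealer R90-C14-plan (g2)), card «FLSUM» dealt BY NAME 2026-09-05T03:11:42Z (spec authority R90-C14-p02 (g3), census `G1-DISCHARGE-CENSUS.md` 7afcecd4b5bbd52f).
THEOREMS ONLY (no `def`, no `instance`, no notation, no named-fact hypothesis, no `sorry`); lane `--supports stmt-HodgeConjecture-24833 --as helper` (count-neutral helper).
-/
import Literature.NumberTheory.Rogawski1990.UnitFundamentalLemmaInertFlickerAlgebra   -- ★ `flicker_theorem15(_div)`; brings ★ `phiZero` `phiOne` `phiH` `phiKappa`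
import HarnessLib

/-!
# R90 · S6 — card «FLSUM» `R90S6FlickerSumClosedForm`: THE UNIT-LEVEL AND LEVEL-ONE `κ`-SUMS OF FLICKER'S CLOSED FORMS AGAINST THE BALL COUNTS OF `X₂`
# `Δ·Σ± Φ(tᵢ) = F₀ + F₁` (level `K₀`) and `Δ·q^k·Σ± Φ(tᵢ↓) = F₀ + F₁ − 2` (level `K₁`), pure arithmetic in `ℚ`

Cell `hodgecm-mathlib`, crux H413 (`stmt-HodgeConjecture-24833`), route `HCCMUnconditional`; programme R90-TF, section S6 (base `R90-C14`), row E1.3.5.2.6 (the elliptic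
identity (E1) of type (1), G1 «E1-DISCHARGE», R90-C14-p02 (g3)).  By p02's census §0 the (E1) row for every shell index `m` collapses to TWO identities between the
twelve fixed-point numbers of the four Flicker literals `t₁ = t_1(a,b,c)`, `t₂ = t_ϖ(a,b,c)`, `t₃ = t_ϖ(a,c,b)`, `t₄ = t_ϖ(b,a,c)` and of the endoscopic element `δ₁` on the
`(q+1)`-regular tree `X₂`:
* **(U0)** `Δ·(V₀(t₁) + V₀(t₂) − V₀(t₃) − V₀(t₄)) = F₀ + F₁` (hyperspecial level), and
* **(U1)** `Δ·(V₁(t₁) + V₁(t₂) − V₁(t₃) − V₁(t₄)) = F₀ + F₁ − 2` (special level),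
`Δ = (−q)^{−(N₁+N₂)}`, `N₁ = v(a−b)`, `N₂ = v(c−b)`, `N = v(a−c)` (the two smallest of `N₁, N₂, N` agree), `F₀ + F₁ = #Ball(x₀, N)` in `X₂`.
THIS FILE is the closed-form ARITHMETIC of both, and nothing else (it asserts nothing about orbital integrals or fixed points; the dictionaries `V₀(tᵢ) = φ`-values are ★
Flicker Props. 11∕14 in the tree (`UnitOrbitalIntegralInertValueThetaZero{Closed,Complete}`, `…ThetaOneClosed`; GF1 2b), `V₁ = 1 + q^k·V₀(one level down)` is ★ R2M ∕
★ rung 1, and `F₀, F₁` are ★ HF1 A3 `R90S6TreeFixDataUnramifiedU2` :96 ∕ :131):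
* §1 the BALL DICTIONARY `phiH q n = 1 + (q+1)·Σ_{j<⌊n∕2⌋} q^{2j+1} + (q+1)·Σ_{j<⌊(n+1)∕2⌋} q^{2j}` (Flicker's H-side value p. 95 = A3's two closed forms summed = `#Ball(x₀, n)`),
  `phiH q 0 = 1`, `phiH q (n+1) − 2 = q·phiH q n`;
* §2 **(U0) in closed forms** = ★ `flicker_theorem15_div` read against §1: `((−q)^{N₁+N₂})⁻¹·(φ₀(N₁,N₂,N) + φ₁(N₁,N) − φ₁(N,N₁) − φ₁(N₁,N₂)) = F₀ + F₁`;
* §3 **(U1) in closed forms** = ★ Theorem 15 ONE LEVEL DOWN: with the LOWERED triple `(N₁−1, N₂−1, N−1)` (truncated subtraction: every positive depth drops by one) and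
  `k = 3` if all three depths are positive (regime R-I, ★ rung 1 `a₁ = 1 + q³·ℓ₁`), `k = 1` if exactly one is (regime R-II, ★ R2M `a₁ = 1 + q·m`):
  `((−q)^{N₁+N₂})⁻¹ · q^k · phiKappa q (N₁−1) (N₂−1) (N−1) = F₀ + F₁ − 2` — scalar bookkeeping `q³·(−q)^{−2}·φ_H(N−1) = q·φ_H(N−1) = φ_H(N) − 2` (R-I),
  `q·(−q)^{−1}·φ_H(0) = −1 = φ_H(0) − 2` (R-II, congruent pair `ab` or `bc`), `q·φ_H(n−1) = φ_H(n) − 2` (R-II, pair `ac`); plus the EXPANDED forms with the four `1 + q^k·φ`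
  summands the consumer's `V₁`-columns produce, and the separated regime R-III (`0 + 1 − 1 − 1 = 1 + 0 − 2`);
* §4 normalisers for the `φ₁` parametrisations in the tree (`phiOne q a N` does not depend on `a ≥ N`; `phiOne q a 0 = 0` is ★ `Flicker1998.phiOne_zero`).
HONEST LABEL: arithmetic over ★ Flicker Theorem 15; proves no printed global statement, discharges no citation; count-neutral helper until p02's (E1) discharge consumes
it.  HC_CM is proved only modulo the 7 printed citations (2 remaining named inputs: hLiu418 = stmt-HodgeConjecture-24832, h413 = stmt-HodgeConjecture-24833) until rung 0 closes.

## References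
* [Flicker1998UnitaryFL] Y. Z. Flicker, *Elementary proof of the fundamental lemma for a unitary group*, Canad. J. Math. 50 (1998), Props. 11, 14, §6 Theorem 15 pp. 95–96.
* [Rogawski1990] J. D. Rogawski, *Automorphic Representations of Unitary Groups in Three Variables* (1990), §4.9 Prop. 4.9.1 (b) pp. 54–56.
* [Kottwitz1988] R. E. Kottwitz, *Tamagawa numbers*, Ann. of Math. 127 (1988), §2 (fixed subtrees; the two parahoric levels).
* [Serre1980Trees] J.-P. Serre, *Trees* (1980), II.1.1 (balls in the `(q+1)`-regular tree).
-/

set_option autoImplicit false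
-- the mandated namespace repeats the single-problem summit's segment (`HodgeConjecture.HodgeConjecture`)
set_option linter.dupNamespace false

open Finset
open Literature.NumberTheory.Rogawski1990.Flicker1998

namespace Summit.HodgeConjecture.HodgeConjecture.R90.S6

variable {q : ℕ}

/-! ## §1 The ball dictionary: `phiH q n` against HF1 A3's two closed forms -/

/-- The two half-range shifts: `⌊(n+2)∕2⌋ = ⌊n∕2⌋ + 1` and `⌊(n+3)∕2⌋ = ⌊(n+1)∕2⌋ + 1`, on the parity pieces
`q^{2⌊n∕2⌋+1} + q^{2⌊(n+1)∕2⌋} = q^n + q^{n+1}`. [cite: Serre1980Trees, II.1.1] -/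
private theorem flickerSum_pow_half_add_pow_half (q n : ℕ) : q ^ (2 * (n / 2) + 1) + q ^ (2 * ((n + 1) / 2)) = q ^ n + q ^ (n + 1) := by
  rcases Nat.even_or_odd' n with ⟨m, rfl | rfl⟩
  · have h1 : 2 * m / 2 = m := by omega
    have h2 : (2 * m + 1) / 2 = m := by omega
    rw [h1, h2, add_comm]
  · have h1 : (2 * m + 1) / 2 = m := by omega
    have h2 : (2 * m + 1 + 1) / 2 = m + 1 := by omega
    rw [h1, h2]
    ring

/-- **The even spheres plus the odd spheres are all spheres**: `Σ_{j<⌊n∕2⌋} q^{2j+1} + Σ_{j<⌊(n+1)∕2⌋} q^{2j} = Σ_{k<n} q^k`. [cite: Serre1980Trees, II.1.1] -/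
theorem flickerSum_sum_half_add_sum_half : ∀ (q n : ℕ),
    (∑ j ∈ Finset.range (n / 2), q ^ (2 * j + 1)) + ∑ j ∈ Finset.range ((n + 1) / 2), q ^ (2 * j) = ∑ k ∈ Finset.range n, q ^ k
  | _, 0 => by simp
  | _, 1 => by simp
  | q, n + 2 => by
    have ih := flickerSum_sum_half_add_sum_half q n
    have h1 : (n + 2) / 2 = n / 2 + 1 := by omega
    have h2 : (n + 2 + 1) / 2 = (n + 1) / 2 + 1 := by omega
    rw [h1, h2, Finset.sum_range_succ, Finset.sum_range_succ, Finset.sum_range_succ, Finset.sum_range_succ, ← ih]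
    have hp := flickerSum_pow_half_add_pow_half q n
    omega

/-- **HF1 A3's two closed forms sum to the ball count**: `1 + (q+1)·Σ_{j<⌊n∕2⌋} q^{2j+1} + (q+1)·Σ_{j<⌊(n+1)∕2⌋} q^{2j} = 1 + (q+1)·Σ_{k<n} q^k` (`= #Ball(x₀, n)` in the
`(q+1)`-regular tree). [cite: Serre1980Trees, II.1.1] [cite: Rogawski1990, §4.9 pp. 54–55] -/
theorem flickerSum_ballClosed_eq (q n : ℕ) :
    1 + (q + 1) * ∑ j ∈ Finset.range (n / 2), q ^ (2 * j + 1) + (q + 1) * ∑ j ∈ Finset.range ((n + 1) / 2), q ^ (2 * j) =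
      1 + (q + 1) * ∑ k ∈ Finset.range n, q ^ k := by
  rw [add_assoc, ← mul_add, flickerSum_sum_half_add_sum_half]

/-- **THE BALL DICTIONARY**: Flicker's H-side value `φ_H(n) = (q^n(q+1) − 2)∕(q−1)` (p. 95) IS the ball count `1 + (q+1)·Σ_{j<⌊n∕2⌋} q^{2j+1} + (q+1)·Σ_{j<⌊(n+1)∕2⌋} q^{2j}`
(★ HF1 A3 :96 + :131 summed), for `q > 1`. [cite: Flicker1998UnitaryFL, §6 p. 95] [cite: Serre1980Trees, II.1.1] -/
theorem flickerSum_phiH_eq_ballClosed (hq : 1 < q) (n : ℕ) :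
    phiH q n = ((1 + (q + 1) * ∑ j ∈ Finset.range (n / 2), q ^ (2 * j + 1) + (q + 1) * ∑ j ∈ Finset.range ((n + 1) / 2), q ^ (2 * j) : ℕ) : ℚ) := by
  rw [flickerSum_ballClosed_eq, phiH, div_eq_iff (cast_sub_one_ne_zero hq)]
  push_cast
  linear_combination ((q : ℚ) + 1) * (geom_sum_mul (q : ℚ) n).symm

/-- `φ_H(0) = 1` (the ball of radius `0`), for `q > 1`. [cite: Flicker1998UnitaryFL, §6 p. 95] -/
theorem flickerSum_phiH_zero (hq : 1 < q) : phiH q 0 = 1 := by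
  rw [flickerSum_phiH_eq_ballClosed hq 0]
  simp

/-- **One more shell**: `φ_H(n+1) − 2 = q·φ_H(n)` (`(q+1)q^{n+1} − 2 − 2(q−1) = q·((q+1)q^n − 2)`), for `q > 1`. [cite: Flicker1998UnitaryFL, §6 p. 95] -/
theorem flickerSum_phiH_succ_sub_two (hq : 1 < q) (n : ℕ) : phiH q (n + 1) - 2 = (q : ℚ) * phiH q n := by
  have h1 := cast_sub_one_ne_zero hq
  simp only [phiH]
  field_simp
  ring

/-! ## §2 (U0): the hyperspecial-level `κ`-sum in closed forms -/

/-- **(U0) IN CLOSED FORMS**: for `q > 1` and a depth triple `(N₁, N₂, N)` whose two smallest members agree,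
`((−q)^{N₁+N₂})⁻¹ · (φ₀(N₁,N₂,N) + φ₁(N₁,N) − φ₁(N,N₁) − φ₁(N₁,N₂)) = 1 + (q+1)·Σ_{j<⌊N∕2⌋} q^{2j+1} + (q+1)·Σ_{j<⌊(N+1)∕2⌋} q^{2j}` — ★ Flicker Theorem 15
(`flicker_theorem15_div`) read against the ball dictionary §1: `Δ·Σ± V₀(tᵢ) = F₀ + F₁`. [cite: Flicker1998UnitaryFL, §6 Theorem 15 pp. 95–96] [cite: Rogawski1990, §4.9 Prop. 4.9.1 (b)] -/
theorem flickerSum_levelZero (hq : 1 < q) {N₁ N₂ N : ℕ} (h : (N₁ = N₂ ∧ N₁ ≤ N) ∨ (N₁ = N ∧ N₁ ≤ N₂) ∨ (N₂ = N ∧ N₂ ≤ N₁)) :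
    ((-(q : ℚ)) ^ (N₁ + N₂))⁻¹ * (phiZero q N₁ N₂ N + phiOne q N₁ N - phiOne q N N₁ - phiOne q N₁ N₂) =
      ((1 + (q + 1) * ∑ j ∈ Finset.range (N / 2), q ^ (2 * j + 1) + (q + 1) * ∑ j ∈ Finset.range ((N + 1) / 2), q ^ (2 * j) : ℕ) : ℚ) := by
  have h15 := flicker_theorem15_div hq h
  simp only [phiKappa] at h15
  rw [h15, flickerSum_phiH_eq_ballClosed hq]

/-! ## §3 (U1): the special-level `κ`-sum in closed forms = Theorem 15 one level down -/

/-- Theorem 15's side condition survives lowering every depth by one (truncated). [cite: Flicker1998UnitaryFL, §6 p. 95] -/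
private theorem flickerSum_lowered_sideCondition {N₁ N₂ N : ℕ} (h : (N₁ = N₂ ∧ N₁ ≤ N) ∨ (N₁ = N ∧ N₁ ≤ N₂) ∨ (N₂ = N ∧ N₂ ≤ N₁)) :
    (N₁ - 1 = N₂ - 1 ∧ N₁ - 1 ≤ N - 1) ∨ (N₁ - 1 = N - 1 ∧ N₁ - 1 ≤ N₂ - 1) ∨ (N₂ - 1 = N - 1 ∧ N₂ - 1 ≤ N₁ - 1) := by
  omega

/-- **(U1) IN CLOSED FORMS, REGIME R-I (all three depths positive, `k = 3`)**: for `q > 1`,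
`((−q)^{N₁+N₂})⁻¹ · q³ · phiKappa q (N₁−1) (N₂−1) (N−1) = F₀ + F₁ − 2` — ★ Theorem 15 at the lowered triple and `q³·(−q)^{−2}·φ_H(N−1) = q·φ_H(N−1) = φ_H(N) − 2`.
(The value law `V₁(tᵢ) = 1 + q³·V₀(tᵢ↓)` is ★ rung 1 `a₁ = 1 + (S−1)·ℓ₁`, `S = q³+1`; not asserted here.) [cite: Flicker1998UnitaryFL, §6 Theorem 15] [cite: Kottwitz1988, §2] -/
theorem flickerSum_levelOne_congruentAll (hq : 1 < q) {N₁ N₂ N : ℕ} (h : (N₁ = N₂ ∧ N₁ ≤ N) ∨ (N₁ = N ∧ N₁ ≤ N₂) ∨ (N₂ = N ∧ N₂ ≤ N₁))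
    (h₁ : 0 < N₁) (h₂ : 0 < N₂) (h₃ : 0 < N) :
    ((-(q : ℚ)) ^ (N₁ + N₂))⁻¹ * ((q : ℚ) ^ 3 * phiKappa q (N₁ - 1) (N₂ - 1) (N - 1)) =
      ((1 + (q + 1) * ∑ j ∈ Finset.range (N / 2), q ^ (2 * j + 1) + (q + 1) * ∑ j ∈ Finset.range ((N + 1) / 2), q ^ (2 * j) : ℕ) : ℚ) - 2 := by
  obtain ⟨a, rfl⟩ := Nat.exists_eq_add_one_of_ne_zero (Nat.pos_iff_ne_zero.1 h₁)
  obtain ⟨b, rfl⟩ := Nat.exists_eq_add_one_of_ne_zero (Nat.pos_iff_ne_zero.1 h₂)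
  obtain ⟨c, rfl⟩ := Nat.exists_eq_add_one_of_ne_zero (Nat.pos_iff_ne_zero.1 h₃)
  rw [flicker_theorem15 hq (flickerSum_lowered_sideCondition h), ← flickerSum_phiH_eq_ballClosed hq, flickerSum_phiH_succ_sub_two hq]
  simp only [Nat.add_sub_cancel]
  have hq0 : (q : ℚ) ≠ 0 := by exact_mod_cast (by omega : q ≠ 0)
  have hX : (-(q : ℚ)) ^ (a + 1 + (b + 1)) ≠ 0 := pow_ne_zero _ (neg_ne_zero.2 hq0)
  rw [inv_mul_eq_iff_eq_mul₀ hX]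
  ring

/-- **(U1) IN CLOSED FORMS, REGIME R-II (exactly one depth positive, `k = 1`)**: for `q > 1`,
`((−q)^{N₁+N₂})⁻¹ · q · phiKappa q (N₁−1) (N₂−1) (N−1) = F₀ + F₁ − 2` — ★ Theorem 15 at the lowered triple and `q·(−q)^{−1}·φ_H(0) = −1 = φ_H(0) − 2` (pair `ab` or `bc`
congruent), `q·φ_H(n−1) = φ_H(n) − 2` (pair `ac` congruent).  (The value law `V₁(tᵢ) = 1 + q·V₀(tᵢ↓)` is ★ R2M `a₁ = 1 + q·m`; not asserted here.)
[cite: Flicker1998UnitaryFL, §6 Theorem 15] [cite: Kottwitz1988, §2] -/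
theorem flickerSum_levelOne_congruentOne (hq : 1 < q) {N₁ N₂ N : ℕ} (h : (N₁ = N₂ ∧ N₁ ≤ N) ∨ (N₁ = N ∧ N₁ ≤ N₂) ∨ (N₂ = N ∧ N₂ ≤ N₁))
    (hpos : 0 < N₁ ∨ 0 < N₂ ∨ 0 < N) (h0 : N₁ = 0 ∨ N₂ = 0 ∨ N = 0) :
    ((-(q : ℚ)) ^ (N₁ + N₂))⁻¹ * ((q : ℚ) * phiKappa q (N₁ - 1) (N₂ - 1) (N - 1)) =
      ((1 + (q + 1) * ∑ j ∈ Finset.range (N / 2), q ^ (2 * j + 1) + (q + 1) * ∑ j ∈ Finset.range ((N + 1) / 2), q ^ (2 * j) : ℕ) : ℚ) - 2 := by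
  have hq0 : (q : ℚ) ≠ 0 := by exact_mod_cast (by omega : q ≠ 0)
  rw [flicker_theorem15 hq (flickerSum_lowered_sideCondition h), ← flickerSum_phiH_eq_ballClosed hq]
  -- exactly one depth is positive: the two smallest agree, so two positive depths and one zero depth are impossible
  rcases Nat.eq_zero_or_pos N₁ with rfl | hN₁ <;> rcases Nat.eq_zero_or_pos N₂ with rfl | hN₂ <;> rcases Nat.eq_zero_or_pos N with rfl | hN
  · -- `(0, 0, 0)` is the separated regime, excluded by `hpos`
    omega
  · -- `(0, 0, n+1)`: pair `ac` congruent
    obtain ⟨c, rfl⟩ := Nat.exists_eq_add_one_of_ne_zero (Nat.pos_iff_ne_zero.1 hN)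
    rw [flickerSum_phiH_succ_sub_two hq]
    simp
  · -- `(0, n+1, 0)`: pair `bc` congruent
    obtain ⟨b, rfl⟩ := Nat.exists_eq_add_one_of_ne_zero (Nat.pos_iff_ne_zero.1 hN₂)
    have hX : (-(q : ℚ)) ^ (0 + (b + 1)) ≠ 0 := pow_ne_zero _ (neg_ne_zero.2 hq0)
    rw [inv_mul_eq_iff_eq_mul₀ hX, flickerSum_phiH_zero hq]
    simp only [Nat.zero_sub, Nat.add_sub_cancel, zero_add, pow_succ]
    ring
  · omega
  · -- `(n+1, 0, 0)`: pair `ab` congruent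
    obtain ⟨a, rfl⟩ := Nat.exists_eq_add_one_of_ne_zero (Nat.pos_iff_ne_zero.1 hN₁)
    have hX : (-(q : ℚ)) ^ (a + 1 + 0) ≠ 0 := pow_ne_zero _ (neg_ne_zero.2 hq0)
    rw [inv_mul_eq_iff_eq_mul₀ hX, flickerSum_phiH_zero hq]
    simp only [Nat.zero_sub, Nat.add_sub_cancel, add_zero, pow_succ]
    ring
  · omega
  · omega
  · omega

/-- **(U1) IN CLOSED FORMS, UNIFORM IN THE DEEP REGIMES** — the scalar `k` explicit: `k = 3` when all three depths are positive (R-I), `k = 1` when one of them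
vanishes (R-II; then exactly one is positive): `((−q)^{N₁+N₂})⁻¹ · q^k · phiKappa q (N₁−1) (N₂−1) (N−1) = F₀ + F₁ − 2`. [cite: Flicker1998UnitaryFL, §6 Theorem 15]
[cite: Kottwitz1988, §2] -/
theorem flickerSum_levelOne (hq : 1 < q) {N₁ N₂ N : ℕ} (h : (N₁ = N₂ ∧ N₁ ≤ N) ∨ (N₁ = N ∧ N₁ ≤ N₂) ∨ (N₂ = N ∧ N₂ ≤ N₁))
    (hpos : 0 < N₁ ∨ 0 < N₂ ∨ 0 < N) (k : ℕ) (hk : (0 < N₁ ∧ 0 < N₂ ∧ 0 < N ∧ k = 3) ∨ ((N₁ = 0 ∨ N₂ = 0 ∨ N = 0) ∧ k = 1)) :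
    ((-(q : ℚ)) ^ (N₁ + N₂))⁻¹ * ((q : ℚ) ^ k * phiKappa q (N₁ - 1) (N₂ - 1) (N - 1)) =
      ((1 + (q + 1) * ∑ j ∈ Finset.range (N / 2), q ^ (2 * j + 1) + (q + 1) * ∑ j ∈ Finset.range ((N + 1) / 2), q ^ (2 * j) : ℕ) : ℚ) - 2 := by
  rcases hk with ⟨h₁, h₂, h₃, rfl⟩ | ⟨h0, rfl⟩
  · exact flickerSum_levelOne_congruentAll hq h h₁ h₂ h₃
  · rw [pow_one]
    exact flickerSum_levelOne_congruentOne hq h hpos h0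

/-- **(U1) EXPANDED, REGIME R-I** — the four special-level columns as the consumer produces them (`V₁(tᵢ) = 1 + q³·φ(tᵢ↓)`):
`Δ·((1 + q³φ₀↓) + (1 + q³φ₁(N₁−1,N−1)) − (1 + q³φ₁(N−1,N₁−1)) − (1 + q³φ₁(N₁−1,N₂−1))) = F₀ + F₁ − 2`. [cite: Flicker1998UnitaryFL, §6 Theorem 15] [cite: Kottwitz1988, §2] -/
theorem flickerSum_levelOne_congruentAll_expanded (hq : 1 < q) {N₁ N₂ N : ℕ} (h : (N₁ = N₂ ∧ N₁ ≤ N) ∨ (N₁ = N ∧ N₁ ≤ N₂) ∨ (N₂ = N ∧ N₂ ≤ N₁))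
    (h₁ : 0 < N₁) (h₂ : 0 < N₂) (h₃ : 0 < N) :
    ((-(q : ℚ)) ^ (N₁ + N₂))⁻¹ *
        ((1 + (q : ℚ) ^ 3 * phiZero q (N₁ - 1) (N₂ - 1) (N - 1)) + (1 + (q : ℚ) ^ 3 * phiOne q (N₁ - 1) (N - 1)) -
          (1 + (q : ℚ) ^ 3 * phiOne q (N - 1) (N₁ - 1)) - (1 + (q : ℚ) ^ 3 * phiOne q (N₁ - 1) (N₂ - 1))) =
      ((1 + (q + 1) * ∑ j ∈ Finset.range (N / 2), q ^ (2 * j + 1) + (q + 1) * ∑ j ∈ Finset.range ((N + 1) / 2), q ^ (2 * j) : ℕ) : ℚ) - 2 := by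
  rw [← flickerSum_levelOne_congruentAll hq h h₁ h₂ h₃, phiKappa]
  ring

/-- **(U1) EXPANDED, REGIME R-II** — the four special-level columns as the consumer produces them (`V₁(tᵢ) = 1 + q·φ(tᵢ↓)`; the two literals whose relevant pair is
separated carry `φ₁(·, 0) = 0`, i.e. `V₁ = 1`): `Δ·((1 + qφ₀↓) + (1 + qφ₁(N₁−1,N−1)) − (1 + qφ₁(N−1,N₁−1)) − (1 + qφ₁(N₁−1,N₂−1))) = F₀ + F₁ − 2`.
[cite: Flicker1998UnitaryFL, §6 Theorem 15] [cite: Kottwitz1988, §2] -/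
theorem flickerSum_levelOne_congruentOne_expanded (hq : 1 < q) {N₁ N₂ N : ℕ} (h : (N₁ = N₂ ∧ N₁ ≤ N) ∨ (N₁ = N ∧ N₁ ≤ N₂) ∨ (N₂ = N ∧ N₂ ≤ N₁))
    (hpos : 0 < N₁ ∨ 0 < N₂ ∨ 0 < N) (h0 : N₁ = 0 ∨ N₂ = 0 ∨ N = 0) :
    ((-(q : ℚ)) ^ (N₁ + N₂))⁻¹ *
        ((1 + (q : ℚ) * phiZero q (N₁ - 1) (N₂ - 1) (N - 1)) + (1 + (q : ℚ) * phiOne q (N₁ - 1) (N - 1)) -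
          (1 + (q : ℚ) * phiOne q (N - 1) (N₁ - 1)) - (1 + (q : ℚ) * phiOne q (N₁ - 1) (N₂ - 1))) =
      ((1 + (q + 1) * ∑ j ∈ Finset.range (N / 2), q ^ (2 * j + 1) + (q + 1) * ∑ j ∈ Finset.range ((N + 1) / 2), q ^ (2 * j) : ℕ) : ℚ) - 2 := by
  rw [← flickerSum_levelOne_congruentOne hq h hpos h0, phiKappa]
  ring

/-- **(U1), REGIME R-III (all depths zero)**: the special-level columns are `(V₁(t₁), V₁(t₂), V₁(t₃), V₁(t₄)) = (0, 1, 1, 1)` (★ R-III rung ∕ ★ FRAMES–COUNTS) and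
`F₀ + F₁ = #Ball(x₀, 0) = 1`: `0 + 1 − 1 − 1 = 1 − 2`, `Δ = 1`. [cite: Flicker1998UnitaryFL, §6 p. 95] -/
theorem flickerSum_levelOne_separated (q : ℕ) :
    ((-(q : ℚ)) ^ (0 + 0))⁻¹ * ((0 : ℚ) + 1 - 1 - 1) =
      ((1 + (q + 1) * ∑ j ∈ Finset.range (0 / 2), q ^ (2 * j + 1) + (q + 1) * ∑ j ∈ Finset.range ((0 + 1) / 2), q ^ (2 * j) : ℕ) : ℚ) - 2 := by
  norm_num

/-- **(U0), REGIME R-III (all depths zero)**: `(V₀(t₁), V₀(t₂), V₀(t₃), V₀(t₄)) = (1, 0, 0, 0)` and `F₀ + F₁ = 1`: `1 + 0 − 0 − 0 = 1`, `Δ = 1` — the same numbers as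
`flickerSum_levelZero` at `(0,0,0)` (`φ₀(0,0,0) = 1`, `φ₁(0,0) = 0`). [cite: Flicker1998UnitaryFL, §6 p. 95] -/
theorem flickerSum_levelZero_separated (hq : 1 < q) : phiZero q 0 0 0 = 1 ∧ phiOne q 0 0 = 0 := by
  have h1 := cast_sub_one_ne_zero hq
  have h4 := cast_pow_four_sub_one_ne_zero hq
  refine ⟨?_, by simp [phiOne]⟩
  rw [phiZero, if_neg (lt_irrefl 0), if_pos (by decide)]
  simp only [max_self, Nat.zero_div, mul_zero, add_zero, pow_zero, mul_one]
  field_simp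
  ring

/-! ## §4 Normalisers for the `φ₁` parametrisations -/

/-- `φ₁(a, N)` does not depend on its first slot as long as `N ≤ a` (Prop. 11's first case) — so the tree's `phiOne q N₊ N` (`N₊ = v(a+c−2b) ≥ N`) and Flicker's
`phiOne q N₁ N` (`N₁ ≥ N`) agree. [cite: Flicker1998UnitaryFL, Prop. 11 p. 87] -/
theorem flickerSum_phiOne_eq_of_le (q : ℕ) {a b N : ℕ} (ha : N ≤ a) (hb : N ≤ b) : phiOne q a N = phiOne q b N := by
  simp only [phiOne, if_pos ha, if_pos hb]

/-- `phiKappa` unfolded: `φ₀(N₁,N₂,N) + φ₁(N₁,N) − φ₁(N,N₁) − φ₁(N₁,N₂)` (the `κ`-signs `+ + − −` over `t₁, t₂, t₃, t₄`). [cite: Flicker1998UnitaryFL, §6 p. 95] -/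
theorem flickerSum_phiKappa_eq (q N₁ N₂ N : ℕ) : phiKappa q N₁ N₂ N = phiZero q N₁ N₂ N + phiOne q N₁ N - phiOne q N N₁ - phiOne q N₁ N₂ := rfl

end Summit.HodgeConjecture.HodgeConjecture.R90.S6
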